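import Mathlib
import Literature.NumberTheory.LFunctions.DeBruijnNewmanProofs
import Literature.NumberTheory.LFunctions.XiIntegralProofs
import Literature.NumberTheory.LFunctions.DeBruijnHZeroProofs

/-!
# RiemannHypothesis / UniversalFactor — decay of `H_0` on the real axis, route-file-independent

Route `RiemannHypothesis/UniversalFactor`, wide window `0 < a < π/8` of the target `LaplaceLoophole`;
this module and its companions `UniversalFactorWideTailStandalone.lean`,
`UniversalFactorEntireFactorStandalone.lean`, `UniversalFactorWideKernelNoGoStandalone.lean` re-prove
the wide-kernel no-go `WideKernelNoGo` (item stmt-RiemannHypothesis-2578) in modules that import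
NEITHER the route file `Summits.RiemannHypothesis.RiemannHypothesis.Theses.UniversalFactor` NOR any
`Theorems/UniversalFactor*.lean` importing it (all of `UniversalFactorWideKernelNoGo.lean`,
`UniversalFactorLaplaceLoopholeWideTail.lean`, `UniversalFactorH0Decay.lean`,
`UniversalFactorLaguerreLift.lean` do), because the gate links a closed item as
`import <proving module>` + `theorem <Decl>_holds` INTO the route file — an import cycle for those
modules (route revs 3 and 5, 2026-08-15/16). Statements here are spelled structurally.

With `H_0 = deBruijnH 0` (`= ξ(1/2 + iz/2)/8`, `deBruijnH_zero_eq_holds`) we prove: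

* `UniversalFactorStandalone.exists_exp_mul_norm_deBruijnH_zero_le` — for every `b < π/8` there is
  `C` with `e^{b|x|}‖H_0(x)‖ ≤ C` for all real `x` (Lagarias–Montague, Lemma 3.3 (1):
  `|ξ(s)| ≤ C₁ e^{−π|t|/4}(|t| + 1)^{5/2}` on `1/2 ≤ Re s ≤ 2`, PROVED in the tree as
  `LagariasMontague2011_lem_3_3_i_holds`; same computation as seat 0's
  `exists_norm_deBruijnH_zero_real_le_exp`, which cannot be imported here);
* `UniversalFactorStandalone.integrableOn_exp_mul_deBruijnH_zero` — `t ↦ e^{ct}H_0(t)` is integrable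
  on `(0, ∞)` for `c < b`;
* `UniversalFactorStandalone.norm_integral_Ioi_exp_neg_mul_deBruijnH_zero_le` — the tail bound
  `‖∫ₓ^∞ e^{−at}H_0(t)dt‖ ≤ C/(a+b) · e^{−(a+b)x}` (`x ≥ 0`).

References: J. C. Lagarias, D. Montague, *The integral of the Riemann ξ-function*, Comment. Math.
Univ. St. Pauli 60 (2011), Lemma 3.3 (1); E. C. Titchmarsh, *The theory of the Riemann
zeta-function* (1986), §10.1.
-/

noncomputable section

namespace Summit.RiemannHypothesis.RiemannHypothesis.Theorems

open MeasureTheory Set Filter Complex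
open scoped Topology
open Literature.NumberTheory.LFunctions

/-! ## Decay of `H_0` on the real axis (Lagarias–Montague) -/

/-- **Weighted decay of `H_0` on the real axis**: for every `b < π/8` there is `C` with
`e^{b|x|} ‖H_0(x)‖ ≤ C` for all real `x` — from `H_0(x) = ξ(1/2 + ix/2)/8` (`deBruijnH_zero_eq_holds`)
and the Lagarias–Montague strip bound `|ξ(s)| ≤ C₁ e^{−π|Im s|/4}(|Im s| + 1)^{5/2}`
(`LagariasMontague2011_lem_3_3_i_holds`), the polynomial factor being absorbed by `e^{−(π/8 − b)|x|}`
(`(r/2 + 1)^{5/2} e^{−δr} ≤ (1 + 3/δ)³`). [cite: LagariasMontague2011, Lemma 3.3 (1)] -/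
theorem UniversalFactorStandalone.exists_exp_mul_norm_deBruijnH_zero_le {b : ℝ} (hb : b < Real.pi / 8) :
    ∃ C : ℝ, ∀ x : ℝ, Real.exp (b * |x|) * ‖deBruijnH 0 (x : ℂ)‖ ≤ C := by
  obtain ⟨C₁, hC₁, hLM⟩ := LagariasMontague2011_lem_3_3_i_holds
  set δ : ℝ := Real.pi / 8 - b with hδ
  have hδ0 : 0 < δ := by rw [hδ]; linarith
  -- absorption of the polynomial factor
  have hpoly : ∀ r : ℝ, 0 ≤ r → (r / 2 + 1) ^ (5 / 2 : ℝ) * Real.exp (-(δ * r)) ≤ (1 + 3 / δ) ^ 3 := by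
    intro r hr
    have h1 : (r / 2 + 1) ^ (5 / 2 : ℝ) ≤ (r + 1) ^ (3 : ℝ) := by
      calc (r / 2 + 1) ^ (5 / 2 : ℝ) ≤ (r + 1) ^ (5 / 2 : ℝ) :=
            Real.rpow_le_rpow (by positivity) (by linarith) (by norm_num)
        _ ≤ (r + 1) ^ (3 : ℝ) := Real.rpow_le_rpow_of_exponent_le (by linarith) (by norm_num)
    have h3 : (r + 1) ^ (3 : ℝ) = (r + 1) ^ 3 := by
      rw [show (3 : ℝ) = ((3 : ℕ) : ℝ) by norm_num, Real.rpow_natCast]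
    have hexp2 : δ * r / 3 + 1 ≤ Real.exp (δ * r / 3) := Real.add_one_le_exp _
    have hkey : r + 1 ≤ (1 + 3 / δ) * Real.exp (δ * r / 3) := by
      have : r = 3 / δ * (δ * r / 3) := by field_simp
      have h4 : 3 / δ * (δ * r / 3) ≤ 3 / δ * Real.exp (δ * r / 3) :=
        mul_le_mul_of_nonneg_left (by linarith) (by positivity)
      have hexp1 : 1 ≤ Real.exp (δ * r / 3) := Real.one_le_exp (by positivity)
      nlinarith
    have hkey3 : (r + 1) ^ 3 ≤ ((1 + 3 / δ) * Real.exp (δ * r / 3)) ^ 3 :=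
      pow_le_pow_left₀ (by linarith) hkey 3
    have hexp3 : Real.exp (δ * r / 3) ^ 3 * Real.exp (-(δ * r)) = 1 := by
      rw [← Real.exp_nat_mul, ← Real.exp_add]
      convert Real.exp_zero using 2
      push_cast
      ring
    calc (r / 2 + 1) ^ (5 / 2 : ℝ) * Real.exp (-(δ * r))
        ≤ (r + 1) ^ 3 * Real.exp (-(δ * r)) := by
          rw [← h3]; exact mul_le_mul_of_nonneg_right h1 (Real.exp_pos _).le
      _ ≤ ((1 + 3 / δ) * Real.exp (δ * r / 3)) ^ 3 * Real.exp (-(δ * r)) :=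
          mul_le_mul_of_nonneg_right hkey3 (Real.exp_pos _).le
      _ = (1 + 3 / δ) ^ 3 * (Real.exp (δ * r / 3) ^ 3 * Real.exp (-(δ * r))) := by ring
      _ = (1 + 3 / δ) ^ 3 := by rw [hexp3, mul_one]
  refine ⟨C₁ / 8 * (1 + 3 / δ) ^ 3, fun x => ?_⟩
  set s : ℂ := 1 / 2 + Complex.I * x / 2 with hs
  have hsre : s.re = 1 / 2 := by simp [hs]
  have hsim : s.im = x / 2 := by simp [hs]
  have hH : deBruijnH 0 (x : ℂ) = riemannXi s / 8 := by rw [deBruijnH_zero_eq_holds]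
  have hξ := hLM s (by rw [hsre]) (by rw [hsre]; norm_num)
  rw [hsim] at hξ
  have habs : |x / 2| = |x| / 2 := by rw [abs_div, abs_two]
  rw [habs] at hξ
  rw [hH, norm_div, Complex.norm_ofNat]
  have hx0 : 0 ≤ |x| := abs_nonneg x
  have hsplit : Real.exp (b * |x|) * (Real.exp (-(Real.pi / 4) * (|x| / 2)) * (|x| / 2 + 1) ^ (5 / 2 : ℝ)) =
      (|x| / 2 + 1) ^ (5 / 2 : ℝ) * Real.exp (-(δ * |x|)) := by
    have : Real.exp (b * |x|) * Real.exp (-(Real.pi / 4) * (|x| / 2)) = Real.exp (-(δ * |x|)) := by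
      rw [← Real.exp_add]; congr 1; rw [hδ]; ring
    rw [← mul_assoc, this]; ring
  calc Real.exp (b * |x|) * (‖riemannXi s‖ / 8)
      ≤ Real.exp (b * |x|) * (C₁ * Real.exp (-(Real.pi / 4) * (|x| / 2)) * (|x| / 2 + 1) ^ (5 / 2 : ℝ) / 8) := by
        gcongr
    _ = C₁ / 8 * (Real.exp (b * |x|) * (Real.exp (-(Real.pi / 4) * (|x| / 2)) * (|x| / 2 + 1) ^ (5 / 2 : ℝ))) := by
        ring
    _ = C₁ / 8 * ((|x| / 2 + 1) ^ (5 / 2 : ℝ) * Real.exp (-(δ * |x|))) := by rw [hsplit]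
    _ ≤ C₁ / 8 * (1 + 3 / δ) ^ 3 := by gcongr; exact hpoly |x| hx0

/-! ## `e^{ct} H_0(t)` on half-lines: integrability and the tail bound -/

/-- For `c < b` and `e^{b|t|}‖H_0(t)‖ ≤ C`: `t ↦ e^{ct} H_0(t)` is integrable on `(0, ∞)`. [folklore] -/
theorem UniversalFactorStandalone.integrableOn_exp_mul_deBruijnH_zero {b c C : ℝ} (hcb : c < b)
    (hH : ∀ x : ℝ, Real.exp (b * |x|) * ‖deBruijnH 0 (x : ℂ)‖ ≤ C) :
    IntegrableOn (fun t : ℝ ↦ Complex.exp ((c : ℂ) * t) * deBruijnH 0 (t : ℂ)) (Ioi 0) := by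
  have hmeas : AEStronglyMeasurable (fun t : ℝ ↦ Complex.exp ((c : ℂ) * t) * deBruijnH 0 (t : ℂ))
      (volume.restrict (Ioi (0:ℝ))) := by
    refine (Continuous.mul (by fun_prop) ?_).aestronglyMeasurable
    exact (differentiable_deBruijnH_holds 0).continuous.comp Complex.continuous_ofReal
  refine (((exp_neg_integrableOn_Ioi 0 (by linarith : 0 < b - c)).const_mul C)).mono' hmeas
    (ae_restrict_of_forall_mem measurableSet_Ioi fun t (ht : 0 < t) ↦ ?_)
  rw [norm_mul, Complex.norm_exp]
  have hre : ((c : ℂ) * t).re = c * t := by simp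
  rw [hre]
  have hsplit : Real.exp (c * t) = Real.exp (-(b - c) * t) * Real.exp (b * |t|) := by
    rw [← Real.exp_add, abs_of_pos ht]; ring_nf
  rw [hsplit, mul_assoc, mul_comm]
  exact mul_le_mul_of_nonneg_right (hH t) (Real.exp_pos _).le

/-- The tail bound: for `a, b > 0`, `x ≥ 0` and `e^{b|t|}‖H_0(t)‖ ≤ C`,
`‖∫ₓ^∞ e^{−at} H_0(t) dt‖ ≤ C/(a+b) · e^{−(a+b)x}`. [folklore] -/
theorem UniversalFactorStandalone.norm_integral_Ioi_exp_neg_mul_deBruijnH_zero_le {a b C : ℝ}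
    (ha : 0 < a) (hb : 0 < b) (hH : ∀ x : ℝ, Real.exp (b * |x|) * ‖deBruijnH 0 (x : ℂ)‖ ≤ C)
    {x : ℝ} (hx : 0 ≤ x) :
    ‖∫ t in Ioi x, Complex.exp (((-a : ℝ) : ℂ) * (t : ℂ)) * deBruijnH 0 (t : ℂ)‖ ≤
      C / (a + b) * Real.exp (-((a + b) * x)) := by
  have hab : -(a + b) < 0 := by linarith
  have hint : IntegrableOn (fun t : ℝ ↦ C * Real.exp (-(a + b) * t)) (Ioi x) :=
    (integrableOn_exp_mul_Ioi hab x).const_mul C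
  calc ‖∫ t in Ioi x, Complex.exp (((-a : ℝ) : ℂ) * (t : ℂ)) * deBruijnH 0 (t : ℂ)‖
      ≤ ∫ t in Ioi x, C * Real.exp (-(a + b) * t) := by
        refine norm_integral_le_of_norm_le hint
          (ae_restrict_of_forall_mem measurableSet_Ioi fun t (ht : x < t) ↦ ?_)
        have ht0 : 0 < t := lt_of_le_of_lt hx ht
        rw [norm_mul, Complex.norm_exp]
        have hre : (((-a : ℝ) : ℂ) * t).re = -a * t := by simp
        rw [hre]
        have hsplit : Real.exp (-a * t) = Real.exp (-(a + b) * t) * Real.exp (b * |t|) := by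
          rw [← Real.exp_add, abs_of_pos ht0]; ring_nf
        rw [hsplit, mul_assoc, mul_comm]
        exact mul_le_mul_of_nonneg_right (hH t) (Real.exp_pos _).le
    _ = C * (-Real.exp (-(a + b) * x) / -(a + b)) := by
        rw [integral_const_mul, integral_exp_mul_Ioi hab x]
    _ = C / (a + b) * Real.exp (-((a + b) * x)) := by
        rw [neg_div_neg_eq, neg_mul]
        field_simp

end Summit.RiemannHypothesis.RiemannHypothesis.Theorems
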